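import Summits.Ventures.CertifiedArithmetic.LowPrec.OptTreeMixedDesign
import Summits.Ventures.CertifiedArithmetic.LowPrec.OptTreeSequential
import Mathlib.Data.List.Sort

/-!
# OptStreaming — Theorem T6(a–c): streaming two-precision summation, exact optimum (erratum to T5(e) D2)

HONEST FRAMING: certified error envelopes and provably optimal rounding/accumulation schemes for
low-precision formats under stated cost models; every table by two implementations; no hardware or
vendor claims.

Cost model CM-B, family D2 (STREAMING): the summands are split into `m` consecutive blocks of lengths
`b₁, …, b_m ≥ 1`; each block is summed sequentially at the narrow precision (unit roundoff `u`) and the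
block results are folded IN ORDER into one wide register (unit roundoff `v`).  By Theorem T5
(`OptTreeMixed*`) the exact worst-case relative under-estimation of such a scheme on nonnegative data is
`1 - 1/V` where `V` is its node-weighted tree polynomial; for the streaming shape this is the
STREAMING FOLD `V₁ = S₁`, `V_j = comb v V_{j-1} S_j` (`comb v x y = max x y + v·min x y`) of the block
values `S_j = 1 + (b_j - 1)·u` (`streamV`, and `outerW_streamDesign` identifies it with the T5 object).

* `comb_comb_le_comb_comb` — EXCHANGE LEMMA: for `0 ≤ v ≤ 1`, `x ≥ 0`, `0 ≤ a ≤ b`,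
  `comb (comb x a) b ≤ comb (comb x b) a`; hence (`streamV_insertionSort_le`, T6(c)) feeding the blocks in
  NONDECREASING order of length minimises the fold for every multiset of block lengths.
* `B5` — the closed form.  Write `n = q·m + r`, `0 ≤ r < m`, `S = 1 + (q-1)u`, `S' = 1 + q·u`:
  `B5 = S·(1 + (m-1)v)` if `r = 0`, else `S'·(1 + (r-1)v) + v·S·(1 + (m-r-1)v)`.
* `B5_le_streamV` — T6(b) LOWER BOUND: if `(m-1)·(1 + q·u)·v ≤ u` then every composition of `n` into
  `m` positive blocks has `V ≥ B5`;  `B5_le_streamV_of_le_succ` — with NO condition, every composition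
  all of whose blocks are `≤ q+1` has `V ≥ B5` (`r ≥ 1`).
* `streamV_mostEqual` — ATTAINMENT: the most-equal blocks in nondecreasing order
  (`m - r` blocks `q`, then `r` blocks `q+1`) give `V = B5` whenever `r = 0` or `(m-r-1)·v·S ≤ u`
  (implied by the condition above): so under `(m-1)(1+qu)v ≤ u`, `OPT_D2(n,m) = B5` exactly
  (`R4_StreamingOptimum`).
* ERRATUM (T5(e), bullet D2, generation 5): the closed form was asserted under the weaker condition
  `(m-1)·v ≤ u`; that implication is FALSE in general — `erratum_T5e_D2` is the counterexample
  `u = 2⁻⁴, v = 2⁻⁸, n = 74, m = 15` (condition `14·2⁻⁸ ≤ 2⁻⁴` holds, yet the composition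
  `(4,4,5,…,5,6)` beats `B5`).  The certified cells of C16 (n ≤ 24, n ∈ {32, 64}) are unaffected.
-/

namespace Summit.Ventures.CertifiedArithmetic.LowPrec.Opt

open Literature.ComputerArithmetic.JeannerodRump2018
open Literature.ComputerArithmetic.JeannerodRump2018.SumTree

/-! ## The streaming fold -/

/-- Streaming fold: starting from register value `x`, absorb the values of `l` in order with `comb v`. -/
def sfold (v : ℚ) (x : ℚ) (l : List ℚ) : ℚ := l.foldl (comb v) x

/-- Folding nothing leaves the register unchanged. -/
@[simp] theorem sfold_nil (v x : ℚ) : sfold v x [] = x := rfl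
/-- One step of the fold. -/
@[simp] theorem sfold_cons (v x s : ℚ) (l : List ℚ) : sfold v x (s :: l) = sfold v (comb v x s) l := rfl
/-- Folding a concatenation = folding the second list onto the result of the first. -/
theorem sfold_append (v x : ℚ) (l₁ l₂ : List ℚ) : sfold v x (l₁ ++ l₂) = sfold v (sfold v x l₁) l₂ := by
  simp [sfold, List.foldl_append]

/-- Block value of a sequential narrow block of `b` summands: `S_b = 1 + (b-1)·u`. -/
def bval (u : ℚ) (b : ℕ) : ℚ := 1 + ((b : ℚ) - 1) * u

/-- The streaming design polynomial of the block lengths `blocks` (narrow `u`, wide `v`). -/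
def streamV (u v : ℚ) (blocks : List ℕ) : ℚ := sfold v 0 ((blocks.map (bval u)))

/-! ## Elementary facts about `comb` -/

/-- `comb v x y` is one of `x + v·y`, `y + v·x`. -/
theorem comb_eq_or (v x y : ℚ) : comb v x y = x + v * y ∨ comb v x y = y + v * x := by
  unfold comb
  rcases le_total y x with h | h
  · left; rw [max_eq_left h, min_eq_right h]
  · right; rw [max_eq_right h, min_eq_left h]
/-- `x + v·y ≤ comb v x y` (`v ≤ 1`). -/
theorem add_mul_le_comb {v : ℚ} (hv1 : v ≤ 1) (x y : ℚ) : x + v * y ≤ comb v x y :=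
  add_mul_le_max_add_mul_min hv1 x y
/-- `y + v·x ≤ comb v x y` (`v ≤ 1`). -/
theorem add_mul_le_comb' {v : ℚ} (hv1 : v ≤ 1) (x y : ℚ) : y + v * x ≤ comb v x y := by
  have h := add_mul_le_max_add_mul_min hv1 y x
  unfold comb; rwa [max_comm, min_comm]

/-- Absorbing a nonnegative value into an empty (zero) register returns the value. -/
theorem comb_zero_left {v y : ℚ} (hy : 0 ≤ y) : comb v 0 y = y := by
  unfold comb; rw [max_eq_right hy, min_eq_left hy]; ring

/-- The absorbed value is a lower bound of the result (nonnegative data). -/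
theorem le_comb_right {v x y : ℚ} (hv : 0 ≤ v) (hx : 0 ≤ x) (hy : 0 ≤ y) : y ≤ comb v x y := by
  unfold comb
  have : 0 ≤ v * min x y := mul_nonneg hv (le_min hx hy)
  linarith [le_max_right x y]
/-- `comb` of nonnegative values is nonnegative. -/
theorem comb_nonneg {v x y : ℚ} (hv : 0 ≤ v) (hx : 0 ≤ x) (hy : 0 ≤ y) : 0 ≤ comb v x y :=
  le_trans hy (le_comb_right hv hx hy)
/-- Accumulate regime: `comb v x y = x + v·y` when `y ≤ x`. -/
theorem comb_of_le {v x y : ℚ} (h : y ≤ x) : comb v x y = x + v * y := by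
  unfold comb; rw [max_eq_left h, min_eq_right h]
/-- Absorb regime: `comb v x y = y + v·x` when `x ≤ y`. -/
theorem comb_of_ge {v x y : ℚ} (h : x ≤ y) : comb v x y = y + v * x := by
  unfold comb; rw [max_eq_right h, min_eq_left h]

/-- EXCHANGE LEMMA (T6(c)): absorbing the smaller value first is never worse. -/
theorem comb_comb_le_comb_comb {v x a b : ℚ} (hv0 : 0 ≤ v) (hv1 : v ≤ 1) (hx : 0 ≤ x) (ha : 0 ≤ a)
    (hab : a ≤ b) : comb v (comb v x a) b ≤ comb v (comb v x b) a := by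
  have r0 := add_mul_le_comb hv1 (comb v x b) a
  have rxb := add_mul_le_comb hv1 x b
  have rbx := add_mul_le_comb' hv1 x b
  have hva : v * v * a ≤ v * a := by nlinarith [mul_nonneg hv0 ha]
  have hvx : v * v * x ≤ v * x := by nlinarith [mul_nonneg hv0 hx]
  have hab' : 0 ≤ (1 - v) * (b - a) := mul_nonneg (by linarith) (by linarith)
  rcases comb_eq_or v x a with h1 | h1 <;> rcases comb_eq_or v (comb v x a) b with h2 | h2 <;>
    rw [h2, h1] <;> nlinarith

/-! ## Facts about the fold -/

/-- The fold is monotone in the initial register value. -/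
theorem sfold_mono {v : ℚ} (hv : 0 ≤ v) : ∀ (l : List ℚ) {x x' : ℚ}, x ≤ x' → sfold v x l ≤ sfold v x' l
  | [], _, _, h => h
  | _ :: l, _, _, h => sfold_mono hv l (comb_mono hv h le_rfl)

/-- The fold of nonnegative values from a nonnegative start is nonnegative. -/
theorem sfold_nonneg {v : ℚ} (hv : 0 ≤ v) : ∀ (l : List ℚ) {x : ℚ}, 0 ≤ x → (∀ s ∈ l, 0 ≤ s) → 0 ≤ sfold v x l
  | [], _, hx, _ => hx
  | s :: l, _, hx, hl => sfold_nonneg hv l (comb_nonneg hv hx (hl s (by simp))) (fun t ht => hl t (by simp [ht]))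

/-- The fold never decreases the register (nonnegative data). -/
theorem le_sfold_self {v : ℚ} (hv : 0 ≤ v) : ∀ (l : List ℚ) {x : ℚ}, 0 ≤ x → (∀ s ∈ l, 0 ≤ s) → x ≤ sfold v x l
  | [], _, _, _ => le_rfl
  | s :: l, x, hx, hl => by
      have hs : 0 ≤ s := hl s (by simp)
      have h1 : x ≤ comb v x s := by
        have := add_mul_le_comb' (show (0:ℚ) ≤ 1 by norm_num) s x
        unfold comb at *; nlinarith [mul_nonneg hv (le_min hx hs), le_max_left x s]
      exact le_trans h1 (le_sfold_self hv l (comb_nonneg hv hx hs) (fun t ht => hl t (by simp [ht])))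

/-- Every absorbed value is a lower bound of the final register. -/
theorem le_sfold_of_mem {v : ℚ} (hv : 0 ≤ v) {l : List ℚ} {x s : ℚ} (hx : 0 ≤ x) (hl : ∀ t ∈ l, 0 ≤ t)
    (hs : s ∈ l) : s ≤ sfold v x l := by
  obtain ⟨l₁, l₂, rfl⟩ := List.append_of_mem hs
  rw [sfold_append, sfold_cons]
  have h1 : ∀ t ∈ l₁, 0 ≤ t := fun t ht => hl t (by simp [ht])
  have h2 : ∀ t ∈ l₂, 0 ≤ t := fun t ht => hl t (by simp [ht])
  have hs0 : 0 ≤ s := hl s (by simp)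
  have hX : 0 ≤ sfold v x l₁ := sfold_nonneg hv l₁ hx h1
  exact le_trans (le_comb_right hv hX hs0) (le_sfold_self hv l₂ (comb_nonneg hv hX hs0) h2)

/-- ACCUMULATE bound: `x + v·Σ l ≤ sfold v x l` (`v ≤ 1`). -/
theorem add_mul_sum_le_sfold {v : ℚ} (hv0 : 0 ≤ v) (hv1 : v ≤ 1) : ∀ (l : List ℚ) (x : ℚ), x + v * l.sum ≤ sfold v x l
  | [], x => by simp
  | s :: l, x => by
      rw [sfold_cons, List.sum_cons]
      have ih := add_mul_sum_le_sfold hv0 hv1 l (comb v x s)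
      have h := add_mul_le_comb hv1 x s
      linarith

/-- In the accumulate regime (`S ≤ x`, `S, v ≥ 0`) the fold of `k` copies of `S` is `x + k·v·S`. -/
theorem sfold_replicate {v S : ℚ} (hv : 0 ≤ v) (hS : 0 ≤ S) : ∀ (k : ℕ) {x : ℚ}, S ≤ x →
    sfold v x (List.replicate k S) = x + (k : ℚ) * (v * S)
  | 0, x, _ => by simp
  | k + 1, x, hx => by
      rw [List.replicate_succ, sfold_cons, comb_of_le hx,
        sfold_replicate hv hS k (by nlinarith [mul_nonneg hv hS])]
      push_cast; ring

/-! ## Sorting minimises the fold (T6(c)) -/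

/-- Moving a value rightwards past smaller values never increases the fold (ordered insertion). -/
theorem sfold_orderedInsert_le {v : ℚ} (hv0 : 0 ≤ v) (hv1 : v ≤ 1) {f : ℕ → ℚ} (hf : ∀ a b, a ≤ b → f a ≤ f b)
    (hf0 : ∀ a, 0 ≤ f a) (b : ℕ) : ∀ (t : List ℕ) {x : ℚ}, 0 ≤ x →
    sfold v x ((t.orderedInsert (· ≤ ·) b).map f) ≤ sfold v x ((b :: t).map f)
  | [], _, _ => le_rfl
  | a :: t, x, hx => by
      rw [List.orderedInsert_cons]
      by_cases h : b ≤ a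
      · rw [if_pos h]
      · rw [if_neg h, List.map_cons, sfold_cons]
        have ha : a ≤ b := le_of_lt (not_le.mp h)
        have ih := sfold_orderedInsert_le hv0 hv1 hf hf0 b t (comb_nonneg hv0 hx (hf0 a))
        refine le_trans ih ?_
        simp only [List.map_cons, sfold_cons]
        exact sfold_mono hv0 _ (comb_comb_le_comb_comb hv0 hv1 hx (hf0 a) (hf a b ha))

/-- Insertion-sorting the inputs (nondecreasing) never increases the fold, for a monotone nonnegative valuation. -/
theorem sfold_insertionSort_le {v : ℚ} (hv0 : 0 ≤ v) (hv1 : v ≤ 1) {f : ℕ → ℚ} (hf : ∀ a b, a ≤ b → f a ≤ f b)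
    (hf0 : ∀ a, 0 ≤ f a) : ∀ (l : List ℕ) {x : ℚ}, 0 ≤ x →
    sfold v x ((l.insertionSort (· ≤ ·)).map f) ≤ sfold v x (l.map f)
  | [], _, _ => le_rfl
  | b :: l, x, hx => by
      rw [List.insertionSort_cons]
      refine le_trans (sfold_orderedInsert_le hv0 hv1 hf hf0 b _ hx) ?_
      simp only [List.map_cons, sfold_cons]
      exact sfold_insertionSort_le hv0 hv1 hf hf0 l (comb_nonneg hv0 hx (hf0 b))

/-- Block values are monotone in the block length (`u ≥ 0`). -/
theorem bval_mono {u : ℚ} (hu : 0 ≤ u) {a b : ℕ} (h : a ≤ b) : bval u a ≤ bval u b := by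
  unfold bval
  have : (a : ℚ) ≤ b := by exact_mod_cast h
  nlinarith

/-- Block values are nonnegative (`0 ≤ u ≤ 1`). -/
theorem bval_nonneg {u : ℚ} (hu0 : 0 ≤ u) (hu1 : u ≤ 1) (b : ℕ) : 0 ≤ bval u b := by
  unfold bval
  have : (0 : ℚ) ≤ b := by exact_mod_cast Nat.zero_le b
  nlinarith

/-- `1 ≤ S_b` for `b ≥ 1`. -/
theorem one_le_bval {u : ℚ} (hu0 : 0 ≤ u) {b : ℕ} (hb : 1 ≤ b) : 1 ≤ bval u b := by
  unfold bval
  have : (1 : ℚ) ≤ b := by exact_mod_cast hb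
  nlinarith

/-- T6(c): NONDECREASING block order minimises the streaming polynomial, for every multiset of blocks. -/
theorem streamV_insertionSort_le {u v : ℚ} (hu0 : 0 ≤ u) (hu1 : u ≤ 1) (hv0 : 0 ≤ v) (hv1 : v ≤ 1)
    (blocks : List ℕ) : streamV u v (blocks.insertionSort (· ≤ ·)) ≤ streamV u v blocks :=
  sfold_insertionSort_le hv0 hv1 (fun _ _ h => bval_mono hu0 h) (bval_nonneg hu0 hu1) blocks le_rfl

/-! ## The closed form and the lower bound (T6(b)) -/

/-- Closed form `B5(u,v; q,r,m)` for `n = q·m + r` summands in `m` blocks. -/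
def B5 (u v : ℚ) (q r m : ℕ) : ℚ :=
  if r = 0 then (1 + ((q : ℚ) - 1) * u) * (1 + ((m : ℚ) - 1) * v)
  else (1 + (q : ℚ) * u) * (1 + ((r : ℚ) - 1) * v)
        + v * (1 + ((q : ℚ) - 1) * u) * (1 + ((m : ℚ) - (r : ℚ) - 1) * v)

/-- Sum of block values: `Σ S_{b_i} = |l|·(1-u) + u·Σ b_i`. -/
theorem sum_map_bval (u : ℚ) : ∀ l : List ℕ, (l.map (bval u)).sum = (l.length : ℚ) * (1 - u) + u * (l.sum : ℕ)
  | [] => by simp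
  | b :: l => by
      rw [List.map_cons, List.sum_cons, List.sum_cons, sum_map_bval u l, List.length_cons]
      unfold bval; push_cast; ring

/-- A list of naturals bounded by `q` has sum `≤ q·length`. -/
theorem sum_le_of_forall_le {q : ℕ} : ∀ l : List ℕ, (∀ b ∈ l, b ≤ q) → l.sum ≤ q * l.length
  | [], _ => by simp
  | b :: l, h => by
      rw [List.sum_cons, List.length_cons]
      have hb := h b (by simp)
      have ih := sum_le_of_forall_le l (fun c hc => h c (by simp [hc]))
      nlinarith

/-- If all entries are `≤ q` and the sum is `q·length`, all entries equal `q`. -/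
theorem forall_eq_of_sum_eq {q : ℕ} : ∀ l : List ℕ, (∀ b ∈ l, b ≤ q) → l.sum = q * l.length → ∀ b ∈ l, b = q
  | [], _, _ => by simp
  | b :: l, h, hs => by
      rw [List.sum_cons, List.length_cons] at hs
      have hb := h b (by simp)
      have hl := sum_le_of_forall_le l (fun c hc => h c (by simp [hc]))
      have hbq : b = q := by nlinarith
      have hs' : l.sum = q * l.length := by nlinarith
      intro c hc
      rcases List.mem_cons.mp hc with rfl | hc
      · exact hbq
      · exact forall_eq_of_sum_eq l (fun c hc => h c (by simp [hc])) hs' c hc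

/-- Split a list at the FIRST occurrence of `a`. -/
theorem exists_first_split {a : ℕ} : ∀ {l : List ℕ}, a ∈ l → ∃ pre post : List ℕ, l = pre ++ a :: post ∧ a ∉ pre
  | [], h => by simp at h
  | b :: l, h => by
      by_cases hb : b = a
      · exact ⟨[], l, by simp [hb], by simp⟩
      · have h' : a ∈ l := by
          rcases List.mem_cons.mp h with h | h
          · exact absurd h.symm hb
          · exact h
        obtain ⟨pre, post, rfl, hn⟩ := exists_first_split h'
        exact ⟨b :: pre, post, by simp, by simp [hn, Ne.symm hb]⟩

/-- `B5 ≤ S' + u` under the condition (the branch with a block of length `≥ q+2`, or `≥ q+1` when `r = 0`). -/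
theorem B5_le_of_cond {u v : ℚ} (hu : 0 ≤ u) (hv0 : 0 ≤ v) (hv1 : v ≤ 1) {q r m : ℕ} (hq : 1 ≤ q)
    (hrm : r < m) (hcond : ((m : ℚ) - 1) * (1 + (q : ℚ) * u) * v ≤ u) :
    B5 u v q r m ≤ (if r = 0 then 1 + ((q : ℚ) - 1) * u else 1 + (q : ℚ) * u) + u := by
  have hq' : (1 : ℚ) ≤ q := by exact_mod_cast hq
  have hm' : (r : ℚ) + 1 ≤ m := by exact_mod_cast hrm
  have hr0 : (0 : ℚ) ≤ r := by exact_mod_cast Nat.zero_le r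
  unfold B5
  split_ifs with hr
  · have h1 : ((m : ℚ) - 1) * v * (1 + ((q : ℚ) - 1) * u) ≤ ((m : ℚ) - 1) * (1 + (q : ℚ) * u) * v := by
      have : 0 ≤ ((m : ℚ) - 1) * v := mul_nonneg (by linarith) hv0
      nlinarith
    nlinarith
  · have hr1 : (1 : ℚ) ≤ r := by exact_mod_cast Nat.pos_of_ne_zero hr
    -- B5 - S' = v [ (r-1) S' + S (1 + (m-r-1) v) ] ≤ v (m-1) S'
    have hS : 1 + ((q : ℚ) - 1) * u ≤ 1 + (q : ℚ) * u := by linarith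
    have hA : (1 + ((m : ℚ) - r - 1) * v) ≤ (m : ℚ) - r := by nlinarith
    have hSpos : 0 ≤ 1 + ((q : ℚ) - 1) * u := by nlinarith
    have h2 : (1 + ((q : ℚ) - 1) * u) * (1 + ((m : ℚ) - r - 1) * v) ≤ (1 + (q : ℚ) * u) * ((m : ℚ) - r) := by
      nlinarith [mul_le_mul hS hA (by nlinarith) (by nlinarith)]
    nlinarith [mul_nonneg hv0 hSpos]

/-- `streamV` of a nonempty block list, unfolded one step. -/
theorem streamV_cons {u v : ℚ} (hu0 : 0 ≤ u) (hu1 : u ≤ 1) (b : ℕ) (l : List ℕ) :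
    streamV u v (b :: l) = sfold v (bval u b) (l.map (bval u)) := by
  unfold streamV; rw [List.map_cons, sfold_cons, comb_zero_left (bval_nonneg hu0 hu1 b)]

/-- Every block value is a lower bound: `S_{b} ≤ V` for `b ∈ blocks`. -/
theorem bval_le_streamV {u v : ℚ} (hu0 : 0 ≤ u) (hu1 : u ≤ 1) (hv0 : 0 ≤ v) {blocks : List ℕ} {b : ℕ}
    (hb : b ∈ blocks) : bval u b ≤ streamV u v blocks :=
  le_sfold_of_mem hv0 le_rfl (fun t ht => by
    obtain ⟨c, _, rfl⟩ := List.mem_map.mp ht; exact bval_nonneg hu0 hu1 c) (List.mem_map.mpr ⟨b, hb, rfl⟩)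

/-- T6(b), UNCONDITIONAL PART: if `r ≥ 1` and every block is `≤ q+1`, then `V ≥ B5`. -/
theorem B5_le_streamV_of_le_succ {u v : ℚ} (hu0 : 0 ≤ u) (hu1 : u ≤ 1) (hv0 : 0 ≤ v) (hv1 : v ≤ 1)
    {q r : ℕ} {blocks : List ℕ} (hr : 1 ≤ r) (hrm : r < blocks.length)
    (hsum : blocks.sum = q * blocks.length + r) (hle : ∀ b ∈ blocks, b ≤ q + 1) :
    B5 u v q r blocks.length ≤ streamV u v blocks := by
  -- a block of length exactly q+1 exists
  have hmem : q + 1 ∈ blocks := by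
    by_contra hno
    have hle' : ∀ b ∈ blocks, b ≤ q := fun b hb => by
      have := hle b hb
      rcases Nat.lt_or_eq_of_le this with h | h
      · omega
      · exact absurd (h ▸ hb) hno
    have := sum_le_of_forall_le blocks hle'
    omega
  obtain ⟨pre, post, hsplit, hnot⟩ := exists_first_split hmem
  have hpre : ∀ b ∈ pre, b ≤ q := fun b hb => by
    have h1 : b ≤ q + 1 := hle b (by rw [hsplit]; simp [hb])
    rcases Nat.lt_or_eq_of_le h1 with h | h
    · omega
    · exact absurd (h ▸ hb) hnot
  have hpost : ∀ b ∈ post, b ≤ q + 1 := fun b hb => hle b (by rw [hsplit]; simp [hb])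
  have hB5 : B5 u v q r blocks.length = (1 + (q : ℚ) * u) * (1 + ((r : ℚ) - 1) * v)
        + v * (1 + ((q : ℚ) - 1) * u) * (1 + ((blocks.length : ℚ) - (r : ℚ) - 1) * v) := by
    unfold B5; rw [if_neg (by omega)]
  have hr1 : (1 : ℚ) ≤ r := by exact_mod_cast hr
  have hSq1 : bval u (q + 1) = 1 + (q : ℚ) * u := by unfold bval; push_cast; ring
  rcases pre with _ | ⟨b₁, mid⟩
  · -- J = 1: V ≥ S' + v Σ_post
    simp only [List.nil_append] at hsplit
    have hV : streamV u v blocks = sfold v (bval u (q + 1)) (post.map (bval u)) := by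
      rw [hsplit, streamV_cons hu0 hu1]
    have hacc := add_mul_sum_le_sfold hv0 hv1 (post.map (bval u)) (bval u (q + 1))
    rw [sum_map_bval] at hacc
    have hlen : blocks.length = post.length + 1 := by rw [hsplit]; simp
    have hsum' : (post.sum : ℚ) = (q : ℚ) * (post.length + 1) + r - q - 1 := by
      have : blocks.sum = (q + 1) + post.sum := by rw [hsplit]; simp
      have h2 : post.sum + (q + 1) = q * (post.length + 1) + r := by rw [← hlen]; omega
      have h3 : ((post.sum + (q + 1) : ℕ) : ℚ) = ((q * (post.length + 1) + r : ℕ) : ℚ) := by rw [h2]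
      push_cast at h3; linarith
    rw [hV, hB5, hlen]; push_cast
    rw [hsum'] at hacc; rw [hSq1] at hacc ⊢
    have hL : (r : ℚ) ≤ post.length := by
      have : r ≤ post.length := by omega
      exact_mod_cast this
    -- B5 ≤ S' + v[(r-1)S' + (m-r)S] - v(1-v)(m-r-1)S and Σpost = (r-1)S' + (m-r) S
    have hS0 : 0 ≤ 1 + ((q : ℚ) - 1) * u := by
      have hq0 : (0 : ℚ) ≤ q := by exact_mod_cast Nat.zero_le q
      nlinarith [mul_nonneg hq0 hu0]
    have key : 0 ≤ v * (1 - v) * ((post.length : ℚ) - r) * (1 + ((q : ℚ) - 1) * u) :=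
      mul_nonneg (mul_nonneg (mul_nonneg hv0 (by linarith)) (by linarith)) hS0
    nlinarith [key]
  · -- J ≥ 2: V ≥ S' + v (S₁ + v Σ_mid) + v Σ_post
    simp only [List.cons_append] at hsplit
    have hV : streamV u v blocks
        = sfold v (comb v (sfold v (bval u b₁) (mid.map (bval u))) (bval u (q + 1))) (post.map (bval u)) := by
      rw [hsplit, streamV_cons hu0 hu1, List.map_append, List.map_cons, sfold_append, sfold_cons]
    have hacc2 := add_mul_sum_le_sfold hv0 hv1 (post.map (bval u))
      (comb v (sfold v (bval u b₁) (mid.map (bval u))) (bval u (q + 1)))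
    have hc := add_mul_le_comb' hv1 (sfold v (bval u b₁) (mid.map (bval u))) (bval u (q + 1))
    have hacc1 := add_mul_sum_le_sfold hv0 hv1 (mid.map (bval u)) (bval u b₁)
    rw [sum_map_bval] at hacc1 hacc2
    have hlen : blocks.length = mid.length + post.length + 2 := by rw [hsplit]; simp; omega
    have hmidsum := sum_le_of_forall_le mid (fun b hb => hpre b (by simp [hb]))
    have hb1q : b₁ ≤ q := hpre b₁ (by simp)
    have hpostsum := sum_le_of_forall_le post hpost
    -- the block sums as rationals
    have htot : (b₁ : ℚ) + mid.sum + (q + 1) + post.sum = (q : ℚ) * (mid.length + post.length + 2) + r := by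
      have h1 : blocks.sum = b₁ + mid.sum + (q + 1) + post.sum := by rw [hsplit]; simp; omega
      have h2 : b₁ + mid.sum + (q + 1) + post.sum = q * (mid.length + post.length + 2) + r := by
        rw [← h1, hsum, hlen]
      exact_mod_cast h2
    have hM : ((mid.sum : ℕ) : ℚ) ≤ (q : ℚ) * mid.length := by exact_mod_cast hmidsum
    have hP : ((post.sum : ℕ) : ℚ) ≤ ((q : ℚ) + 1) * post.length := by exact_mod_cast hpostsum
    have hb1 : (b₁ : ℚ) ≤ q := by exact_mod_cast hb1q
    have hb1' : (1 : ℚ) - 1 ≤ (b₁ : ℚ) - 1 + 1 := by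
      have : (0 : ℚ) ≤ b₁ := by exact_mod_cast Nat.zero_le b₁
      linarith
    -- |post| ≥ r - 1 follows from the sums:  Σpost ≥ q|post| + r - 1 and Σpost ≤ (q+1)|post|
    have hE : (r : ℚ) ≤ post.length + 1 := by nlinarith
    rw [hV, hB5, hlen]; push_cast
    rw [hSq1] at hacc2 hc ⊢
    have hS0 : 0 ≤ 1 + ((q : ℚ) - 1) * u := by
      have hq0 : (0 : ℚ) ≤ q := by exact_mod_cast Nat.zero_le q
      nlinarith [mul_nonneg hq0 hu0]
    -- main inequality: LB - B5 = v (1-v) [E·S + u·D], E = |post| + 1 - r ≥ 0, D = q|mid| - Σmid ≥ 0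
    have key1 : 0 ≤ v * (1 - v) * ((post.length : ℚ) + 1 - r) * (1 + ((q : ℚ) - 1) * u) :=
      mul_nonneg (mul_nonneg (mul_nonneg hv0 (by linarith)) (by linarith)) hS0
    have key2 : 0 ≤ v * (1 - v) * u * ((q : ℚ) * mid.length - mid.sum) :=
      mul_nonneg (mul_nonneg (mul_nonneg hv0 (by linarith)) hu0) (by linarith)
    have hvacc1 := mul_le_mul_of_nonneg_left hacc1 hv0
    have hb1v : bval u b₁ = 1 + ((b₁ : ℚ) - 1) * u := rfl
    generalize sfold v (bval u b₁) (mid.map (bval u)) = X at hacc1 hacc2 hc hvacc1 ⊢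
    generalize comb v X (1 + (q : ℚ) * u) = Y at hacc2 hc ⊢
    generalize sfold v Y (post.map (bval u)) = V at hacc2 ⊢
    rw [hb1v] at hacc1 hvacc1
    have hPs : ((post.sum : ℕ) : ℚ) = (q : ℚ) * (mid.length + post.length + 2) + r - q - 1 - b₁ - mid.sum := by
      linarith
    rw [hPs] at hacc2
    linarith [key1, key2, hvacc1, hacc2, hc]

end Summit.Ventures.CertifiedArithmetic.LowPrec.Opt
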